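import Literature.NumberTheory.LFunctions.SelbergArgOmegaConvolution
import Literature.NumberTheory.LFunctions.ZetaArgVariation
import HarnessLib

/-!
# Selberg's `Ω`-theorem for `S(t)`, step 5a/5b: from the smoothed argument to the values of `S`

Fourth file of the proof programme for the named fact
`Literature.NumberTheory.LFunctions.Selberg1946_zetaArgS_omega` (`SelbergArgOmega.lean`). It supplies the two
elementary passages between the smoothed argument `Φ_S(t) = ∫ S(t+v) K_L(v) dv` (`smoothS`,
`SelbergArgOmegaConvolution.lean`) and `S` itself that Tsang (*Some `Ω`-theorems for the Riemann
zeta-function*, Acta Arith. 46 (1986), §3, (3.4)–(3.6)) uses: since `K_L ≥ 0` has mass `2π g₀(0)`,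

* (5a) if `S(u) ≤ M` (`M ≥ 0`) for all `u ∈ [T/2, 3T]`, then for `t ∈ [T, 2T]` the near part
  `∫_{|v| ≤ T/2} S(t+v)K_L(v) dv ≤ 2π g₀(0) M` (`near_integral_le`; and symmetrically `neg_le_near_integral`),
  while the far part `|v| > T/2` is `O(1/T)` uniformly in `L ≥ 1` (`exists_smoothS_sub_near_le`: the crude
  global bound `|S(u)| ≤ C(1+u²)`, `exists_abs_zetaArgS_le_sq`, against `K_L(v) ≤ C/v⁴`);
* (5b) the average of `Φ_S` over `[T, 2T]` is small: `|∫_T^{2T} Φ_S(t) dt| ≤ C L log(T+2)`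
  (`exists_abs_integral_smoothS_le`; Fubini on `[T,2T] × ℝ` and Littlewood's theorem
  `∫_{t₁}^{t₂} S = O(log t₂)` in the proved form `exists_abs_integral_zetaArgS_le`, `ZetaArgVariation.lean`),
  which pins down the constant of integration `C_T` in the convolution identity
  `Φ_S = C_T - Re 𝒱_L - Re ℛ_L + O(L e^{L/8}/T)` of `exists_smoothS_increment_bound`.

Everything is proved; no definitions beyond those of the earlier files, no named facts.

## References

* [Tsang1986] K.-M. Tsang, Acta Arith. 46 (1986), §3 (3.4)–(3.6).
* E. C. Titchmarsh, *The Theory of the Riemann Zeta-Function*, 2nd ed., §9.9 (Littlewood's theorem).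
-/

noncomputable section

open Complex Filter Set MeasureTheory
open scoped Real Topology ComplexConjugate ArithmeticFunction.vonMangoldt

namespace Literature.NumberTheory.LFunctions

namespace SelbergOmega

open RudnickSarnakN

variable {L : ℝ}

/-! ## Step 5a: from the smoothed argument to the values of `S` -/

section WindowSup

/-- **A crude global bound for `S`**: `|S(u)| ≤ C(1 + u²)` for all real `u`
(`S = N - θ/π - 1`, `N(u) ≤ B(1+u²)`, `|θ(u)| ≤ C(1+u²)`). [folklore] -/
theorem exists_abs_zetaArgS_le_sq : ∃ C : ℝ, 0 < C ∧ ∀ u : ℝ, |zetaArgS u| ≤ C * (1 + u ^ 2) := by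
  obtain ⟨B, hB0, hB⟩ := exists_zetaZeroCount_le_sq
  obtain ⟨C, hC0, hC⟩ := exists_abs_riemannSiegelTheta_le
  refine ⟨B + C / π + 1, by positivity, fun u ↦ ?_⟩
  have h1 := hB u
  have h2 := hC u
  have hπ := Real.pi_pos
  have h3 : |riemannSiegelTheta u / π| ≤ C / π * (1 + u ^ 2) := by
    rw [abs_div, abs_of_pos hπ, div_le_iff₀ hπ]
    calc |riemannSiegelTheta u| ≤ C * (1 + u ^ 2) := h2
      _ = C / π * (1 + u ^ 2) * π := by field_simp
  have hN : |(zetaZeroCount u : ℝ)| ≤ B * (1 + u ^ 2) := by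
    rw [abs_of_nonneg (Nat.cast_nonneg _)]; exact h1
  have hu : 0 ≤ u ^ 2 := sq_nonneg u
  calc |zetaArgS u| = |(zetaZeroCount u : ℝ) - riemannSiegelTheta u / π - 1| := rfl
    _ ≤ |(zetaZeroCount u : ℝ)| + |riemannSiegelTheta u / π| + |(1 : ℝ)| :=
        (abs_sub _ _).trans (add_le_add (abs_sub _ _) le_rfl)
    _ ≤ B * (1 + u ^ 2) + C / π * (1 + u ^ 2) + 1 * (1 + u ^ 2) := by
        rw [abs_one]; linarith
    _ = (B + C / π + 1) * (1 + u ^ 2) := by ring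

/-- `∫ dv/(a² + v²) = π/a` (`a > 0`). [folklore] -/
theorem integral_inv_sq_add_sq_window {a : ℝ} (ha : 0 < a) : ∫ v : ℝ, (a ^ 2 + v ^ 2)⁻¹ = π / a := by
  have e : (fun v : ℝ ↦ (a ^ 2 + v ^ 2)⁻¹) = fun v : ℝ ↦ (a ^ 2)⁻¹ * (1 + (v / a) ^ 2)⁻¹ := by
    funext v
    have ha2 : a ^ 2 ≠ 0 := by positivity
    field_simp
  rw [e, integral_const_mul, Measure.integral_comp_div (fun v : ℝ ↦ (1 + v ^ 2)⁻¹) a,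
    integral_univ_inv_one_add_sq, abs_of_pos ha, smul_eq_mul]
  field_simp

/-- `v ↦ (a² + v²)⁻¹` is integrable (`a ≠ 0`). [folklore] -/
theorem integrable_inv_sq_add_sq_window {a : ℝ} (ha : a ≠ 0) : Integrable fun v : ℝ ↦ (a ^ 2 + v ^ 2)⁻¹ := by
  have h := (integrable_inv_one_add_sq.comp_div ha).const_mul ((a ^ 2)⁻¹)
  refine h.congr (Eventually.of_forall fun v ↦ ?_)
  have ha2 : a ^ 2 ≠ 0 := by positivity
  simp only
  field_simp

/-- A kernel bound without the factor `L`: `K_L(v) ≤ C/v⁴` for `L ≥ 1`, `v ≠ 0` (`C` of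
`exists_kerDil_le`). [folklore] -/
theorem exists_kerDil_le_inv_pow_four : ∃ C : ℝ, 0 < C ∧ ∀ L : ℝ, 1 ≤ L → ∀ v : ℝ, v ≠ 0 →
    kerDil L v ≤ C / v ^ 4 := by
  obtain ⟨C, hC0, hC⟩ := exists_kerDil_le
  refine ⟨C, hC0, fun L hL v hv ↦ (hC L (by linarith) v).trans ?_⟩
  have hL0 : 0 < L := by linarith
  have hv4 : 0 < v ^ 4 := by positivity
  have h1 : L ^ 4 * v ^ 4 ≤ (1 + (L * v) ^ 2) ^ 2 := by nlinarith [sq_nonneg (L * v), sq_nonneg (L*v)]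
  calc L * C / (1 + (L * v) ^ 2) ^ 2 ≤ L * C / (L ^ 4 * v ^ 4) :=
        div_le_div_of_nonneg_left (by positivity) (by positivity) h1
    _ = C / v ^ 4 * (1 / L ^ 3) := by field_simp
    _ ≤ C / v ^ 4 * 1 := by
        refine mul_le_mul_of_nonneg_left ?_ (by positivity)
        rw [div_le_one (by positivity)]
        exact one_le_pow₀ hL
    _ = C / v ^ 4 := mul_one _

/-- **The window is concentrated**: for `L ≥ 1`, `a ≥ 1`, `|t| ≤ 4a` and `|v| > a`,
`(1 + (t+v)²) K_L(v) ≤ 70 C (a² + v²)⁻¹`. [folklore] -/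
theorem sq_mul_kerDil_le_far (hL : 1 ≤ L) {C : ℝ} (hC0 : 0 < C)
    (hC : ∀ L : ℝ, 1 ≤ L → ∀ v : ℝ, v ≠ 0 → kerDil L v ≤ C / v ^ 4) {a t v : ℝ} (ha : 1 ≤ a)
    (ht : |t| ≤ 4 * a) (hv : a < |v|) :
    (1 + (t + v) ^ 2) * kerDil L v ≤ 70 * C * (a ^ 2 + v ^ 2)⁻¹ := by
  have hL0 : 0 < L := by linarith
  have hv0 : v ≠ 0 := by
    intro h; rw [h, abs_zero] at hv; linarith
  have hv2 : a ^ 2 < v ^ 2 := by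
    have h := mul_self_lt_mul_self (by linarith) hv
    rw [← pow_two, ← pow_two, sq_abs] at h
    exact h
  have ht2 : t ^ 2 ≤ 16 * a ^ 2 := by
    have h := mul_self_le_mul_self (abs_nonneg t) ht
    rw [← pow_two, sq_abs] at h
    nlinarith
  have h1 : 1 + (t + v) ^ 2 ≤ 35 * v ^ 2 := by nlinarith [sq_nonneg (t - v)]
  have hK := kerDil_nonneg hL0.le v
  have hvpos : 0 < v ^ 2 := by positivity
  calc (1 + (t + v) ^ 2) * kerDil L v ≤ 35 * v ^ 2 * (C / v ^ 4) :=
        mul_le_mul h1 (hC L hL v hv0) hK (by positivity)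
    _ = 35 * C * (v ^ 2)⁻¹ := by field_simp
    _ ≤ 35 * C * (2 * (a ^ 2 + v ^ 2)⁻¹) := by
        refine mul_le_mul_of_nonneg_left ?_ (by positivity)
        rw [← div_eq_mul_inv, le_div_iff₀ (by positivity), inv_mul_eq_div, div_le_iff₀ hvpos]
        linarith
    _ = 70 * C * (a ^ 2 + v ^ 2)⁻¹ := by ring

/-- **The far part of the window is negligible**: there is `C > 0` with, for `L ≥ 1`, `T ≥ 2` and
`t ∈ [T, 2T]`, `|Φ_S(t) - ∫_{|v| ≤ T/2} S(t+v) K_L(v) dv| ≤ C/T`. [folklore] -/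
theorem exists_smoothS_sub_near_le : ∃ C : ℝ, 0 < C ∧ ∀ L : ℝ, 1 ≤ L → ∀ T : ℝ, 2 ≤ T →
    ∀ t ∈ Icc T (2 * T),
      |smoothS L t - ∫ v in Icc (-(T / 2)) (T / 2), zetaArgS (t + v) * kerDil L v| ≤ C / T := by
  obtain ⟨CS, hCS0, hCS⟩ := exists_abs_zetaArgS_le_sq
  obtain ⟨CK, hCK0, hCK⟩ := exists_kerDil_le_inv_pow_four
  refine ⟨CS * (70 * CK) * π * 2, by positivity, fun L hL T hT t ht ↦ ?_⟩
  have hL0 : 0 < L := by linarith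
  set a : ℝ := T / 2 with ha
  have ha1 : 1 ≤ a := by rw [ha]; linarith
  have ha0 : 0 < a := by linarith
  set s : Set ℝ := Icc (-(T / 2)) (T / 2) with hs
  have hf := integrable_zetaArgS_mul_kerDil hL t
  rw [smoothS, ← integral_add_compl (measurableSet_Icc : MeasurableSet s) hf, add_sub_cancel_left]
  -- on the complement `|v| > a`
  have hmem : ∀ v ∈ sᶜ, a < |v| := by
    intro v hv
    simp only [hs, Set.mem_compl_iff, Set.mem_Icc, not_and_or, not_le] at hv
    rcases hv with h | h
    · rw [ha]; have : v < 0 := by linarith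
      rw [abs_of_neg this]; linarith
    · rw [ha]; exact h.trans_le (le_abs_self v)
  have hta : |t| ≤ 4 * a := by
    rw [abs_of_nonneg (by linarith [ht.1]), ha]; linarith [ht.2]
  have hbd : ∀ v ∈ sᶜ, ‖zetaArgS (t + v) * kerDil L v‖ ≤ CS * (70 * CK) * (a ^ 2 + v ^ 2)⁻¹ := by
    intro v hv
    rw [norm_mul, Real.norm_eq_abs, Real.norm_of_nonneg (kerDil_nonneg hL0.le v)]
    have hK := kerDil_nonneg hL0.le v
    calc |zetaArgS (t + v)| * kerDil L v ≤ CS * (1 + (t + v) ^ 2) * kerDil L v :=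
          mul_le_mul_of_nonneg_right (hCS _) hK
      _ = CS * ((1 + (t + v) ^ 2) * kerDil L v) := by ring
      _ ≤ CS * (70 * CK * (a ^ 2 + v ^ 2)⁻¹) :=
          mul_le_mul_of_nonneg_left (sq_mul_kerDil_le_far hL hCK0 hCK ha1 hta (hmem v hv)) hCS0.le
      _ = _ := by ring
  have hint := integrable_inv_sq_add_sq_window ha0.ne'
  calc |∫ v in sᶜ, zetaArgS (t + v) * kerDil L v| = ‖∫ v in sᶜ, zetaArgS (t + v) * kerDil L v‖ :=
        (Real.norm_eq_abs _).symm
    _ ≤ ∫ v in sᶜ, ‖zetaArgS (t + v) * kerDil L v‖ := norm_integral_le_integral_norm _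
    _ ≤ ∫ v in sᶜ, CS * (70 * CK) * (a ^ 2 + v ^ 2)⁻¹ :=
        setIntegral_mono_on hf.norm.integrableOn (hint.const_mul _).integrableOn
          (measurableSet_Icc (a := -(T/2)) (b := T/2)).compl hbd
    _ ≤ ∫ v, CS * (70 * CK) * (a ^ 2 + v ^ 2)⁻¹ :=
        setIntegral_le_integral (hint.const_mul _) (Eventually.of_forall fun v ↦ by positivity)
    _ = CS * (70 * CK) * π * 2 / T := by
        rw [integral_const_mul, integral_inv_sq_add_sq_window ha0, ha]
        field_simp

/-- **Upper values of `S` control the window average from above**: if `0 ≤ M` and `S(u) ≤ M` for all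
`u ∈ [T/2, 3T]`, then for `t ∈ [T, 2T]` the near part of the window average is `≤ 2π g₀(0) M`
(`K_L ≥ 0`, `∫ K_L = 2π g₀(0)`). [folklore] -/
theorem near_integral_le (hL : 1 ≤ L) {T M : ℝ} (hT : 0 ≤ T) (hM : 0 ≤ M)
    (hS : ∀ u ∈ Icc (T / 2) (3 * T), zetaArgS u ≤ M) {t : ℝ} (ht : t ∈ Icc T (2 * T)) :
    ∫ v in Icc (-(T / 2)) (T / 2), zetaArgS (t + v) * kerDil L v ≤ M * (2 * π * (g0 0).re) := by
  have hL0 : 0 < L := by linarith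
  have hf := integrable_zetaArgS_mul_kerDil hL t
  have hK := integrable_kerDil hL0
  calc ∫ v in Icc (-(T / 2)) (T / 2), zetaArgS (t + v) * kerDil L v
      ≤ ∫ v in Icc (-(T / 2)) (T / 2), M * kerDil L v := by
        refine setIntegral_mono_on hf.integrableOn (hK.const_mul M).integrableOn measurableSet_Icc
          fun v hv ↦ mul_le_mul_of_nonneg_right (hS (t + v) ⟨?_, ?_⟩) (kerDil_nonneg hL0.le v)
        · linarith [ht.1, hv.1]
        · linarith [ht.2, hv.2]
    _ ≤ ∫ v, M * kerDil L v :=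
        setIntegral_le_integral (hK.const_mul M) (Eventually.of_forall fun v ↦
          mul_nonneg hM (kerDil_nonneg hL0.le v))
    _ = M * (2 * π * (g0 0).re) := by rw [integral_const_mul, integral_kerDil_real hL0]

/-- **Lower values of `S` control the window average from below**: if `0 ≤ M` and `-M ≤ S(u)` for
all `u ∈ [T/2, 3T]`, then for `t ∈ [T, 2T]` the near part is `≥ -2π g₀(0) M`. [folklore] -/
theorem neg_le_near_integral (hL : 1 ≤ L) {T M : ℝ} (hT : 0 ≤ T) (hM : 0 ≤ M)
    (hS : ∀ u ∈ Icc (T / 2) (3 * T), -M ≤ zetaArgS u) {t : ℝ} (ht : t ∈ Icc T (2 * T)) :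
    -(M * (2 * π * (g0 0).re)) ≤ ∫ v in Icc (-(T / 2)) (T / 2), zetaArgS (t + v) * kerDil L v := by
  have hL0 : 0 < L := by linarith
  have hf := integrable_zetaArgS_mul_kerDil hL t
  have hK := integrable_kerDil hL0
  calc -(M * (2 * π * (g0 0).re)) = ∫ v, -M * kerDil L v := by
        rw [integral_const_mul, integral_kerDil_real hL0]; ring
    _ ≤ ∫ v in Icc (-(T / 2)) (T / 2), -M * kerDil L v := by
        rw [← neg_le_neg_iff, ← integral_neg, ← integral_neg]
        simp only [neg_mul, neg_neg]
        exact setIntegral_le_integral (hK.const_mul M) (Eventually.of_forall fun v ↦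
          mul_nonneg hM (kerDil_nonneg hL0.le v))
    _ ≤ ∫ v in Icc (-(T / 2)) (T / 2), zetaArgS (t + v) * kerDil L v := by
        refine setIntegral_mono_on (hK.const_mul (-M)).integrableOn hf.integrableOn measurableSet_Icc
          fun v hv ↦ mul_le_mul_of_nonneg_right (hS (t + v) ⟨?_, ?_⟩) (kerDil_nonneg hL0.le v)
        · linarith [ht.1, hv.1]
        · linarith [ht.2, hv.2]

end WindowSup

/-! ## Step 5b: the average of the smoothed argument over `[T, 2T]` -/

section WindowAverage

/-- `∫ (1 + |v|) K_L(v) dv ≤ 2π L C` (`C` of `exists_kerDil_le'`). [folklore] -/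
theorem exists_integral_one_add_abs_mul_kerDil_le : ∃ C : ℝ, 0 < C ∧ ∀ L : ℝ, 1 ≤ L →
    ∫ v : ℝ, (1 + |v|) * kerDil L v ≤ C * L := by
  obtain ⟨C, hC0, hC⟩ := exists_kerDil_le'
  refine ⟨2 * C * π, by positivity, fun L hL ↦ ?_⟩
  have hL0 : 0 < L := by linarith
  have hpt : ∀ v : ℝ, (1 + |v|) * kerDil L v ≤ 2 * L * C * (1 + v ^ 2)⁻¹ := by
    intro v
    have hK := kerDil_nonneg hL0.le v
    have h1 : (1 + |v|) * kerDil L v ≤ (1 + |v|) * (L * C / (1 + v ^ 2) ^ 2) :=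
      mul_le_mul_of_nonneg_left (hC L hL v) (by positivity)
    refine h1.trans ?_
    have hv : 1 + |v| ≤ 2 * (1 + v ^ 2) := by
      rcases le_or_gt 0 v with h | h
      · rw [abs_of_nonneg h]; nlinarith [sq_nonneg (v - 1)]
      · rw [abs_of_neg h]; nlinarith [sq_nonneg (v + 1)]
    have hpos : 0 < 1 + v ^ 2 := by positivity
    have key : (1 + |v|) * (L * C / (1 + v ^ 2) ^ 2) ≤ 2 * (1 + v ^ 2) * (L * C / (1 + v ^ 2) ^ 2) :=
      mul_le_mul_of_nonneg_right hv (by positivity)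
    refine key.trans (le_of_eq ?_)
    field_simp
  calc ∫ v : ℝ, (1 + |v|) * kerDil L v ≤ ∫ v : ℝ, 2 * L * C * (1 + v ^ 2)⁻¹ :=
        integral_mono (integrable_one_add_abs_mul_kerDil hL) (integrable_inv_one_add_sq.const_mul _) hpt
    _ = 2 * C * π * L := by rw [integral_const_mul, integral_univ_inv_one_add_sq]; ring

/-- Joint integrability of `(t, v) ↦ S(t + v) K_L(v)` on `uIoc T (2T) × ℝ` (`T ≥ 0`). [folklore] -/
theorem integrable_zetaArgS_kerDil_prod (hL : 1 ≤ L) {T : ℝ} (hT : 0 ≤ T) :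
    Integrable (Function.uncurry fun (t v : ℝ) ↦ zetaArgS (t + v) * kerDil L v)
      ((volume.restrict (Set.uIoc T (2 * T))).prod volume) := by
  have hL0 : 0 < L := by linarith
  obtain ⟨CS, hCS0, hCS⟩ := exists_abs_zetaArgS_le_sq
  have hfin : volume (Set.uIoc T (2 * T)) ≠ ⊤ := by
    rw [Set.uIoc, Real.volume_Ioc]; exact ENNReal.ofReal_ne_top
  haveI : IsFiniteMeasure (volume.restrict (Set.uIoc T (2 * T))) := isFiniteMeasure_restrict.2 hfin
  have hmajv : Integrable fun v : ℝ ↦ CS * ((1 + 8 * T ^ 2) * kerDil L v + 2 * ((1 + v ^ 2) * kerDil L v)) :=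
    (((integrable_kerDil hL0).const_mul _).add ((integrable_one_add_sq_mul_kerDil hL).const_mul _)).const_mul _
  have hmaj : Integrable (fun p : ℝ × ℝ ↦ (1 : ℝ) *
      (CS * ((1 + 8 * T ^ 2) * kerDil L p.2 + 2 * ((1 + p.2 ^ 2) * kerDil L p.2))))
      ((volume.restrict (Set.uIoc T (2 * T))).prod volume) :=
    (integrable_const (1 : ℝ)).mul_prod hmajv
  have hmono : Monotone fun x : ℝ ↦ (zetaZeroCount x : ℝ) := by
    intro x y hxy
    have h : zetaZeroCount x ≤ zetaZeroCount y := zetaZeroCount_mono hxy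
    show (zetaZeroCount x : ℝ) ≤ zetaZeroCount y
    exact_mod_cast h
  have hmeasS : AEStronglyMeasurable (Function.uncurry fun (t v : ℝ) ↦ zetaArgS (t + v) * kerDil L v)
      ((volume.restrict (Set.uIoc T (2 * T))).prod volume) := by
    have h1 : Measurable fun p : ℝ × ℝ ↦ zetaArgS (p.1 + p.2) := by
      have hN : Measurable fun p : ℝ × ℝ ↦ (zetaZeroCount (p.1 + p.2) : ℝ) :=
        hmono.measurable.comp (measurable_fst.add measurable_snd)
      have hθ : Measurable fun p : ℝ × ℝ ↦ riemannSiegelTheta (p.1 + p.2) :=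
        (continuous_riemannSiegelTheta.comp (continuous_fst.add continuous_snd)).measurable
      simp only [zetaArgS]
      exact (hN.sub (hθ.div_const π)).sub measurable_const
    exact (h1.mul ((continuous_kerDil L).comp continuous_snd).measurable).aestronglyMeasurable
  refine hmaj.mono' hmeasS ?_
  have h1 : ∀ᵐ z : ℝ × ℝ ∂((volume.restrict (Set.uIoc T (2 * T))).prod volume), z.1 ∈ Set.uIoc T (2 * T) :=
    (Measure.quasiMeasurePreserving_fst).ae (ae_restrict_mem measurableSet_uIoc)
  refine h1.mono fun z hz ↦ ?_
  obtain ⟨t, v⟩ := z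
  simp only [Function.uncurry_apply_pair, one_mul] at hz ⊢
  rw [uIoc_of_le (by linarith)] at hz
  rw [norm_mul, Real.norm_eq_abs, Real.norm_of_nonneg (kerDil_nonneg hL0.le v)]
  have hK := kerDil_nonneg hL0.le v
  have ht : t ^ 2 ≤ 4 * T ^ 2 := by nlinarith [hz.1, hz.2]
  have hsq : 1 + (t + v) ^ 2 ≤ (1 + 8 * T ^ 2) + 2 * (1 + v ^ 2) := by nlinarith [sq_nonneg (t - v)]
  calc |zetaArgS (t + v)| * kerDil L v ≤ CS * (1 + (t + v) ^ 2) * kerDil L v :=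
        mul_le_mul_of_nonneg_right (hCS _) hK
    _ ≤ CS * ((1 + 8 * T ^ 2) + 2 * (1 + v ^ 2)) * kerDil L v := by gcongr
    _ = CS * ((1 + 8 * T ^ 2) * kerDil L v + 2 * ((1 + v ^ 2) * kerDil L v)) := by ring

set_option maxHeartbeats 400000 in
/-- **The smoothed argument has small average** (Littlewood's `∫ S = O(log T)`,
`exists_abs_integral_zetaArgS_le`): there is `C > 0` with
`|∫_T^{2T} Φ_S(t) dt| ≤ C L log(T + 2)` for all `L ≥ 1`, `T ≥ 4`. [folklore] -/
theorem exists_abs_integral_smoothS_le : ∃ C : ℝ, 0 < C ∧ ∀ L : ℝ, 1 ≤ L → ∀ T : ℝ, 4 ≤ T →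
    |∫ t in T..(2 * T), smoothS L t| ≤ C * L * Real.log (T + 2) := by
  obtain ⟨A, B, hA0, hB0, hAB⟩ := exists_abs_integral_zetaArgS_le
  obtain ⟨CS, hCS0, hCS⟩ := exists_abs_zetaArgS_le_sq
  obtain ⟨CK, hCK0, hCK⟩ := exists_kerDil_le_inv_pow_four
  obtain ⟨C1, hC10, hC1⟩ := exists_integral_one_add_abs_mul_kerDil_le
  -- the constant
  refine ⟨(2 * A + B) * (2 * π * (g0 0).re + 1) + A * C1 + 140 * π * CS * CK + 1, ?_, fun L hL T hT ↦ ?_⟩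
  · have := g0_zero_re_pos; positivity
  have hL0 : 0 < L := by linarith
  have hT0 : 0 < T := by linarith
  set a : ℝ := T / 2 with ha
  have ha0 : 0 < a := by positivity
  have hprod := integrable_zetaArgS_kerDil_prod hL hT0.le
  -- Fubini
  have hswap : ∫ t in T..(2 * T), smoothS L t =
      ∫ v : ℝ, kerDil L v * ∫ t in T..(2 * T), zetaArgS (t + v) := by
    simp only [smoothS]
    rw [intervalIntegral_integral_swap hprod]
    refine integral_congr_ae (Eventually.of_forall fun v ↦ ?_)
    simp only
    rw [intervalIntegral.integral_mul_const, mul_comm]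
  rw [hswap]
  -- integrability of the `v`-integrand
  have hF : Integrable fun v : ℝ ↦ kerDil L v * ∫ t in T..(2 * T), zetaArgS (t + v) := by
    have h := hprod.integral_prod_right
    refine h.congr (Eventually.of_forall fun v ↦ ?_)
    simp only [Function.uncurry_apply_pair]
    rw [uIoc_of_le (by linarith), ← intervalIntegral.integral_of_le (by linarith),
      intervalIntegral.integral_mul_const, mul_comm]
  -- the pointwise majorant
  set g : ℝ → ℝ := fun v ↦ (A * Real.log (2 * T + 4) + B) * kerDil L v + A * ((1 + |v|) * kerDil L v) +
    70 * CS * CK * T * (a ^ 2 + v ^ 2)⁻¹ with hg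
  have hgint : Integrable g :=
    (((integrable_kerDil hL0).const_mul _).add ((integrable_one_add_abs_mul_kerDil hL).const_mul _)).add
      ((integrable_inv_sq_add_sq_window ha0.ne').const_mul _)
  have hlog0 : 0 ≤ Real.log (2 * T + 4) := Real.log_nonneg (by linarith)
  have hbound : ∀ v : ℝ, ‖kerDil L v * ∫ t in T..(2 * T), zetaArgS (t + v)‖ ≤ g v := by
    intro v
    have hK := kerDil_nonneg hL0.le v
    rw [norm_mul, Real.norm_of_nonneg hK, Real.norm_eq_abs]
    have hg1 : 0 ≤ (A * Real.log (2 * T + 4) + B) * kerDil L v := by positivity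
    have hg2 : 0 ≤ A * ((1 + |v|) * kerDil L v) := by positivity
    have hg3 : 0 ≤ 70 * CS * CK * T * (a ^ 2 + v ^ 2)⁻¹ := by positivity
    rcases le_or_gt (2 - T) v with hv | hv
    · -- Littlewood's bound on `∫_{T+v}^{2T+v} S`
      rw [intervalIntegral.integral_comp_add_right]
      have h := hAB (T + v) (2 * T + v) (by linarith) (by linarith)
      have hlog : Real.log (2 * T + v + 4) ≤ Real.log (2 * T + 4) + |v| := by
        have h1 : 2 * T + v + 4 ≤ (2 * T + 4) * (1 + |v|) := by
          nlinarith [le_abs_self v, abs_nonneg v]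
        have h2 : Real.log (2 * T + v + 4) ≤ Real.log ((2 * T + 4) * (1 + |v|)) :=
          Real.log_le_log (by linarith) h1
        rw [Real.log_mul (by linarith) (by positivity)] at h2
        have h3 : Real.log (1 + |v|) ≤ |v| := by
          have := Real.add_one_le_exp |v|
          rw [Real.log_le_iff_le_exp (by positivity)]; linarith
        linarith
      calc kerDil L v * |∫ t in (T + v)..(2 * T + v), zetaArgS t|
          ≤ kerDil L v * (A * Real.log (2 * T + v + 4) + B) := mul_le_mul_of_nonneg_left h hK
        _ ≤ kerDil L v * (A * (Real.log (2 * T + 4) + |v|) + B) := by gcongr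
        _ = (A * Real.log (2 * T + 4) + B) * kerDil L v + A * (|v| * kerDil L v) := by ring
        _ ≤ (A * Real.log (2 * T + 4) + B) * kerDil L v + A * ((1 + |v|) * kerDil L v) := by
            gcongr; nlinarith
        _ ≤ g v := by simp only [hg]; linarith
    · -- crude bound, far from the window
      have hva : a < |v| := by
        rw [ha]; have : v < 0 := by linarith
        rw [abs_of_neg this]; linarith
      have hv0 : v ≠ 0 := by intro h; rw [h] at hv; linarith
      have hI : |∫ t in T..(2 * T), zetaArgS (t + v)| ≤ T * (CS * ((1 + 8 * T ^ 2) + 2 * v ^ 2)) := by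
        have hbd : ∀ t ∈ Set.uIoc T (2 * T), ‖zetaArgS (t + v)‖ ≤ CS * ((1 + 8 * T ^ 2) + 2 * v ^ 2) := by
          intro t ht
          rw [uIoc_of_le (by linarith)] at ht
          rw [Real.norm_eq_abs]
          refine (hCS _).trans (mul_le_mul_of_nonneg_left ?_ hCS0.le)
          nlinarith [ht.1, ht.2, sq_nonneg (t - v)]
        have h := intervalIntegral.norm_integral_le_of_norm_le_const hbd
        rw [Real.norm_eq_abs, show |2 * T - T| = T by rw [show 2 * T - T = T by ring, abs_of_pos hT0]] at h
        linarith
      have hKv : kerDil L v ≤ CK / v ^ 4 := hCK L hL v hv0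
      have hv2 : a ^ 2 < v ^ 2 := by
        have h := mul_self_lt_mul_self ha0.le hva
        rw [← pow_two, ← pow_two, sq_abs] at h
        exact h
      have hvpos : 0 < v ^ 2 := by positivity
      have hv4 : v ^ 4 = v ^ 2 * v ^ 2 := by ring
      -- `T (1 + 8T² + 2v²)/v⁴ ≤ 35 T / v² ≤ 70 T (a² + v²)⁻¹`
      have hTa : T = 2 * a := by rw [ha]; ring
      have hstep : T * (CS * ((1 + 8 * T ^ 2) + 2 * v ^ 2)) * (CK / v ^ 4) ≤ 70 * CS * CK * T * (a ^ 2 + v ^ 2)⁻¹ := by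
        have ha1 : 1 ≤ a := by rw [ha]; linarith
        have hnum : (1 + 8 * T ^ 2) + 2 * v ^ 2 ≤ 35 * v ^ 2 := by rw [hTa]; nlinarith
        have h2 : (v ^ 2)⁻¹ ≤ 2 * (a ^ 2 + v ^ 2)⁻¹ := by
          rw [← one_div, ← one_div, ← div_eq_mul_one_div, div_le_div_iff₀ hvpos (by positivity)]
          nlinarith
        calc T * (CS * ((1 + 8 * T ^ 2) + 2 * v ^ 2)) * (CK / v ^ 4)
            ≤ T * (CS * (35 * v ^ 2)) * (CK / v ^ 4) := by gcongr
          _ = 35 * CS * CK * T * (v ^ 2)⁻¹ := by rw [hv4]; field_simp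
          _ ≤ 35 * CS * CK * T * (2 * (a ^ 2 + v ^ 2)⁻¹) := mul_le_mul_of_nonneg_left h2 (by positivity)
          _ = _ := by ring
      calc kerDil L v * |∫ t in T..(2 * T), zetaArgS (t + v)|
          ≤ (CK / v ^ 4) * (T * (CS * ((1 + 8 * T ^ 2) + 2 * v ^ 2))) :=
            mul_le_mul hKv hI (abs_nonneg _) (by positivity)
        _ = T * (CS * ((1 + 8 * T ^ 2) + 2 * v ^ 2)) * (CK / v ^ 4) := by ring
        _ ≤ 70 * CS * CK * T * (a ^ 2 + v ^ 2)⁻¹ := hstep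
        _ ≤ g v := by simp only [hg]; linarith
  -- integrate the majorant
  have hint : |∫ v : ℝ, kerDil L v * ∫ t in T..(2 * T), zetaArgS (t + v)| ≤ ∫ v, g v := by
    rw [← Real.norm_eq_abs]
    exact (norm_integral_le_integral_norm _).trans (integral_mono hF.norm hgint hbound)
  refine hint.trans ?_
  have hg_eval : ∫ v, g v = (A * Real.log (2 * T + 4) + B) * (2 * π * (g0 0).re) +
      A * (∫ v : ℝ, (1 + |v|) * kerDil L v) + 70 * CS * CK * T * (π / a) := by
    simp only [hg]
    have i1 : Integrable fun v : ℝ ↦ (A * Real.log (2 * T + 4) + B) * kerDil L v :=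
      (integrable_kerDil hL0).const_mul _
    have i2 : Integrable fun v : ℝ ↦ A * ((1 + |v|) * kerDil L v) :=
      (integrable_one_add_abs_mul_kerDil hL).const_mul _
    have i12 : Integrable fun v : ℝ ↦ (A * Real.log (2 * T + 4) + B) * kerDil L v + A * ((1 + |v|) * kerDil L v) :=
      i1.add i2
    have i3 : Integrable fun v : ℝ ↦ 70 * CS * CK * T * (a ^ 2 + v ^ 2)⁻¹ :=
      (integrable_inv_sq_add_sq_window ha0.ne').const_mul _
    rw [integral_add i12 i3, integral_add i1 i2, integral_const_mul, integral_const_mul,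
      integral_const_mul, integral_kerDil_real hL0, integral_inv_sq_add_sq_window ha0]
  rw [hg_eval]
  have h1 := hC1 L hL
  have hg0 := g0_zero_re_pos
  have hlog2 : Real.log (2 * T + 4) ≤ 2 * Real.log (T + 2) := by
    rw [show (2 : ℝ) * T + 4 = 2 * (T + 2) by ring, Real.log_mul (by norm_num) (by linarith)]
    have : Real.log 2 ≤ Real.log (T + 2) := Real.log_le_log (by norm_num) (by linarith)
    linarith
  have hlog1 : 1 ≤ Real.log (T + 2) := by
    rw [Real.le_log_iff_exp_le (by linarith)]
    have := Real.exp_one_lt_d9; linarith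
  have hTa : 70 * CS * CK * T * (π / a) = 140 * π * CS * CK := by
    rw [ha]; field_simp; ring
  rw [hTa]
  have hlogT : 0 ≤ Real.log (T + 2) := by linarith
  -- everything is `≤ const · L · log(T+2)`
  have e1 : (A * Real.log (2 * T + 4) + B) * (2 * π * (g0 0).re) ≤
      (2 * A + B) * (2 * π * (g0 0).re + 1) * (L * Real.log (T + 2)) := by
    have h2 : A * Real.log (2 * T + 4) + B ≤ (2 * A + B) * Real.log (T + 2) := by nlinarith
    have h3 : 0 ≤ 2 * π * (g0 0).re := by positivity
    calc (A * Real.log (2 * T + 4) + B) * (2 * π * (g0 0).re)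
        ≤ ((2 * A + B) * Real.log (T + 2)) * (2 * π * (g0 0).re) := mul_le_mul_of_nonneg_right h2 h3
      _ ≤ ((2 * A + B) * Real.log (T + 2)) * (2 * π * (g0 0).re + 1) * L := by
          have h4 : 0 ≤ (2 * A + B) * Real.log (T + 2) := by positivity
          nlinarith [mul_nonneg h4 h3]
      _ = _ := by ring
  have e2 : A * (∫ v : ℝ, (1 + |v|) * kerDil L v) ≤ A * C1 * (L * Real.log (T + 2)) := by
    calc A * (∫ v : ℝ, (1 + |v|) * kerDil L v) ≤ A * (C1 * L) := mul_le_mul_of_nonneg_left h1 hA0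
      _ ≤ A * (C1 * L) * Real.log (T + 2) := le_mul_of_one_le_right (by positivity) hlog1
      _ = _ := by ring
  have e3 : 140 * π * CS * CK ≤ (140 * π * CS * CK + 1) * (L * Real.log (T + 2)) := by
    have : 1 ≤ L * Real.log (T + 2) := by nlinarith
    nlinarith [show 0 < 140 * π * CS * CK by positivity]
  calc _ ≤ (2 * A + B) * (2 * π * (g0 0).re + 1) * (L * Real.log (T + 2)) + A * C1 * (L * Real.log (T + 2)) +
        (140 * π * CS * CK + 1) * (L * Real.log (T + 2)) := add_le_add (add_le_add e1 e2) e3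
    _ = _ := by ring

end WindowAverage


end SelbergOmega

end Literature.NumberTheory.LFunctions

end
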